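import Summits.BirchSwinnertonDyer.Rank1Residual.AdditivePotMult.QuadraticBaseChangeMilneQuotientAnyRank
import Summits.BirchSwinnertonDyer.Rank1Residual.AdditivePotMult.QuadraticBaseChangeDescentUnramifiedOddPrime
import HarnessLib

/-!
# The base-change-and-descend ENDs with `r_an(W) ≤ 1` AND `r_an(W^{(d_K)}) ≤ 1` SEPARATELY
# (total analytic rank `2` allowed) (row T-MIL-R2, FILE J-3; seat n1011-p01 GEN 9)

HONEST FRAMING (cell `b2b-bsdres`, run/shared/lean/b2b/bsd-rank1-residual/, verbatim in every
file): the goal of the cell is to DELETE the COMBINATION-SHAPED residual classes of the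
Birch–Swinnerton-Dyer formula for ALL analytic-rank `≤ 1` elliptic curves over `ℚ` — "full BSD
formula for every rank `≤ 1` curve in class `C`" assembled STRICTLY from published theorems — so
that the rank-`≤ 1` remainder becomes exactly the CONSTRUCTION-SHAPED classes, which are TYPED
(missing-input `Prop`s), NOT attempted. This is not "finishing BSD". Sub-classes X3♯(M) / X4(M)
(additive, potentially multiplicative prime; base-change-and-descend): a RESEARCH ROUTE; they stay
CONSTRUCTION-SHAPED; nothing is booked by this file; no mark / label moved. THEOREMS ONLY: no
definition, no named fact, no `sorry`.

## What (row T-MIL-R2, `cells/n1011/skel/T-MIL-R2.md` §1 (g), FILE J-3)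

Every base-change-and-descend END of the T-MIL chain (E-3, F-2, G-1, H-2, H-4b, H-5b/c/d) carries
`hr : W.analyticRank + Wd.analyticRank ≤ 1` for ONE reason: the regulator comparison (FILE E-1)
existed in total rank `≤ 1` only. FILE J-1b proves it in every rank and FILE J-2
(`milneQuotient_ordp_of_tamagawa_anyRank`) discharges Milne's binder `hWR_p` from the odd Tamagawa
identity with NO rank hypothesis. This file restates the hA-free ENDs of FILE H-4b with `hr` SPLIT
into `hr : W.analyticRank ≤ 1` and `hrd : Wd.analyticRank ≤ 1` — a WEAKER hypothesis (so each
theorem here implies the END it twins), everything else VERBATIM; the two bounds themselves stay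
because `hGZK` (rank = analytic rank, `Ш` finite) and FILE D-2's `bsdp_of_pPartOver_of_bsdp_twist_ordp`
need them for each curve:

* `bsdp_of_pPartOver_of_bsdp_twist_quadratic_of_addv_unramified_oddPrime_bothLeOne` (H-4b / H-5b
  END: `d_K` odd squarefree, either signature, additive places prime to `d_K` with the clause
  `p = 3 → ℓ ≠ 3`), `…_oddPrime_of_dvd_discr_bothLeOne` (in-class, `p ∣ d_K`),
  `bsdp_of_pPartOver_of_bsdp_twist_quadratic_bothLeOne` (F-2's merged S₁/S₂ hypothesis);
* `…_of_natAbs_discr_bothLeOne` (H-5c: `|d_K| = p`, `Mult Wd p`, NO local hypothesis),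
  `…_of_natAbs_discr_of_potMult_bothLeOne` (H-5d: `Mult Wd p` discharged from `PotMult W p`);
* class currency: `bsdp_of_classX4M_of_bsdp_twist_noMilne_of_addv_unramified_canonical`,
  `bsdp_of_classX3M_of_bsdp_twist_noMilne_of_addv_unramified_canonical` — **for `(E,p) ∈ X4(M)`
  (resp. X3♯(M)) of analytic rank `≤ 1` whose canonical twist `E^{(p*)}` has analytic rank `≤ 1`:
  `BSD(E,p) ⇐ MissingPPartOverAt(E_K, p) ∧ BSD(E^{(p*)}, p)`**, inputs `hGZK`, `hmod` only. For a
  twist of analytic rank `0` H-4b's `…_rankZero_twist_…_canonical` discharges `BSD(E^{(p*)}, p)`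
  (Skinner 2016 Thm. C / Wuthrich Prop. 21); for a twist of analytic rank `1` it is an X11-type
  `r = 1` multiplicative pair and stays DISPLAYED (`hd`).

Population newly inside an END at `p = 3`, `K = ℚ(√−3)`, `N < 500 000` (census EVIDENCE — a count
of population, no mark / count of record moves — `HOME/b2b-bsdres-n1011-p01/g9/CENSUS-X4M3-R11.md`,
referee-2 §43.5 second source): 107 695 curves additive potentially multiplicative at `3` with
`rank E = rank E^{(−3)} = 1`. THE RESIDUE IS HARDER THERE (referee-2 §43.3 r1): for a `(1,1)` pair
(`r_an(W) = r_an(Wd) = 1`) the displayed `hK : MissingPPartOverAt W' p` is the `p`-part of BSD for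
`W'/K` of ANALYTIC RANK `2` (`L(W_K, s) = L(W, s) · L(Wd, s)`) — a STRICTLY harder typed input than
in the total-rank-`≤ 1` ENDs (rank `≤ 1` over `K`), and `hd : BSDp Wd p` is a rank-one multiplicative
pair; "newly inside an END" is a statement about the SHAPE of the reduction, not a shrink toward
closure.

HONEST LIMITS: exactly H-4b's statements with `hr` split; odd `p`; `d_K` odd squarefree resp.
`|d_K| = p`; `BSDp Wd p` displayed; analytic rank `≥ 2` of either curve over `ℚ` not covered (GZK);
for `(1,1)` pairs the over-`K` residue concerns a curve of analytic rank `2` over `K`; even `d_K`,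
`p = 2`, additive `W` at an unramified `3` with `p = 3` not covered; X3♯(M)/X4(M) stay
CONSTRUCTION-SHAPED (`MissingPPartOverAt` untouched); closes no class; moves no mark; 0 facts.

References: J. S. Milne, Invent. Math. 17 (1972) §1 Thm. 1, §2 [Milne1972ArithmeticAV];
B. Gross, D. Zagier, Invent. Math. 84 (1986) V.§2 [GrossZagier1986]; J. H. Silverman, *AEC*
2nd ed., Prop. VII.5.4 (a), Exercise 10.16 [SilvermanAEC2009]; J. H. Silverman, *ATAEC* V.5.3
[SilvermanATAEC1994]; R. L. Miller, LMS J. Comput. Math. 14 (2011) Def. 1.1 [Miller2011LMS].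
-/

noncomputable section

open scoped Classical NumberField

open WeierstrassCurve NumberField NumberField.InfinitePlace IsDedekindDomain Rat.HeightOneSpectrum
  Literature.NumberTheory.EllipticCurves Literature.NumberTheory.EllipticCurves.Rank1Residual
  Literature.NumberTheory.EllipticCurves.Rank1Residual.Typed
  Literature.NumberTheory.DiophantineGeometry
  Literature.NumberTheory.DiophantineGeometry.UnramifiedBaseChange

namespace Summit.BirchSwinnertonDyer.Rank1Residual.AdditivePotMult

section BothLeOne

variable (W : WeierstrassCurve ℚ) [W.IsElliptic] [W.IsGloballyMinimal] (p : ℕ) [hp : Fact p.Prime]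
  (K : Type) [Field K] [NumberField K]
  (Wd : WeierstrassCurve ℚ) [Wd.IsElliptic] [Wd.IsGloballyMinimal]
  (W' : WeierstrassCurve K) [W'.IsElliptic] [W'.IsGloballyMinimal]

/-- **THE BASE-CHANGE-AND-DESCEND END AT EVERY ODD `p`, EITHER SIGNATURE, FOR `r_an(W) ≤ 1` AND
`r_an(Wd) ≤ 1` SEPARATELY.** `W/ℚ`, `Wd = C_d • W^{(d_K)}`, `W' = C' • W_K` globally minimal;
`[K:ℚ] = 2` with `d_K` odd squarefree; `p` odd; at every place `W` is good ∨ multiplicative ∨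
(`ℓ ∣ d_K` ∧ `Wd` multiplicative) ∨ (additive with `ℓ ∤ d_K` and `p = 3 → ℓ ≠ 3`). THEN
**`BSDp W p ⟸ MissingPPartOverAt W' p ∧ BSDp Wd p`** (`hGZK`, `hmod`). H-4b's
`bsdp_of_pPartOver_of_bsdp_twist_quadratic_of_addv_unramified_oddPrime` with
`r_an(W) + r_an(Wd) ≤ 1` replaced by the two separate bounds: the odd Tamagawa identity is H-4b's
`padicValRat_norm_mul_tamagawaProduct_eq_of_addv_unramified_oddPrime` (rank-free), Milne's binder is
J-2's `milneQuotient_ordp_of_tamagawa_anyRank` (rank-free), the descent is D-2's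
`bsdp_of_pPartOver_of_bsdp_twist_ordp`. NOT CLAIMED: analytic rank `≥ 2` of `W` or `Wd`; even
`d_K`; `p = 2`; additive `W` at an unramified `3` with `p = 3`.
[cite: Milne1972ArithmeticAV, §1 Thm. 1 and §2 (through DokchitserDokchitserAnnals2010, §2.1, proof of Thm. 8)]
[cite: GrossZagier1986, V.§2 (p. 311)] [cite: SilvermanAEC2009, Prop. VII.5.4 (a)]
[cite: Miller2011LMS, Def. 1.1 (arXiv:1010.2431 p. 3)] -/
theorem bsdp_of_pPartOver_of_bsdp_twist_quadratic_of_addv_unramified_oddPrime_bothLeOne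
    (hGZK : rank_eq_analyticRank_of_analyticRank_le_one) (hmod : hasEntireLFunction_rat)
    (h2 : Module.finrank ℚ K = 2)
    (hdodd : Odd (NumberField.discr K)) (hdsq : Squarefree (NumberField.discr K))
    {Cd : VariableChange ℚ} (hWd : Cd • W.quadraticTwist (NumberField.discr K : ℚ) = Wd)
    {C' : VariableChange K} (hW' : C' • W.baseChange K = W')
    (hr : W.analyticRank ≤ 1) (hrd : Wd.analyticRank ≤ 1) (hp2 : p ≠ 2)
    (hS : ∀ v : HeightOneSpectrum (𝓞 ℚ), W.HasGoodReductionAt v ∨ W.HasMultiplicativeReductionAt v ∨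
      (((primesEquiv v : ℕ) : ℤ) ∣ NumberField.discr K ∧ Wd.HasMultiplicativeReductionAt v) ∨
      (W.HasAdditiveReductionAt v ∧ ¬ ((primesEquiv v : ℕ) : ℤ) ∣ NumberField.discr K ∧
        (p = 3 → (primesEquiv v : ℕ) ≠ 3)))
    (hK : MissingPPartOverAt W' p) (hd : BSDp Wd p) : BSDp W p := by
  obtain ⟨-, hfinW⟩ := hGZK W hr
  obtain ⟨-, hfinD⟩ := hGZK Wd hrd
  haveI : Finite W.sha := hfinW
  haveI : Finite Wd.sha := hfinD
  exact bsdp_of_pPartOver_of_bsdp_twist_ordp W p K Wd W' hGZK hmod hr h2 ⟨Cd, hWd⟩ hrd ⟨C', hW'⟩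
    (milneQuotient_ordp_of_tamagawa_anyRank W K Wd W' h2 hWd hW' p hp2
      (padicValRat_norm_mul_tamagawaProduct_eq_of_addv_unramified_oddPrime W p K Wd W' h2 hdodd hdsq
        hWd hW' hp2 hS)) hK hd

/-- **The in-class form, `K` RAMIFIED at `p` (`p ∣ d_K`; e.g. `ℚ(√p*)`, `ℚ(√−3)` at `p = 3`), for
`r_an(W) ≤ 1` and `r_an(Wd) ≤ 1` separately**: the clause `p = 3 → ℓ ≠ 3` is automatic, the local
hypothesis is G-1's S₃ shape. H-4b's `…_oddPrime_of_dvd_discr` with `hr` split.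
[cite: Milne1972ArithmeticAV, §1 Thm. 1 and §2 (through DokchitserDokchitserAnnals2010, §2.1, proof of Thm. 8)]
[cite: SilvermanAEC2009, Prop. VII.5.4 (a)] [cite: Miller2011LMS, Def. 1.1 (arXiv:1010.2431 p. 3)] -/
theorem bsdp_of_pPartOver_of_bsdp_twist_quadratic_of_addv_unramified_oddPrime_of_dvd_discr_bothLeOne
    (hGZK : rank_eq_analyticRank_of_analyticRank_le_one) (hmod : hasEntireLFunction_rat)
    (h2 : Module.finrank ℚ K = 2)
    (hdodd : Odd (NumberField.discr K)) (hdsq : Squarefree (NumberField.discr K))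
    (hpd : (p : ℤ) ∣ NumberField.discr K)
    {Cd : VariableChange ℚ} (hWd : Cd • W.quadraticTwist (NumberField.discr K : ℚ) = Wd)
    {C' : VariableChange K} (hW' : C' • W.baseChange K = W')
    (hr : W.analyticRank ≤ 1) (hrd : Wd.analyticRank ≤ 1) (hp2 : p ≠ 2)
    (hS : ∀ v : HeightOneSpectrum (𝓞 ℚ), W.HasGoodReductionAt v ∨ W.HasMultiplicativeReductionAt v ∨
      (((primesEquiv v : ℕ) : ℤ) ∣ NumberField.discr K ∧ Wd.HasMultiplicativeReductionAt v) ∨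
      (W.HasAdditiveReductionAt v ∧ ¬ ((primesEquiv v : ℕ) : ℤ) ∣ NumberField.discr K))
    (hK : MissingPPartOverAt W' p) (hd : BSDp Wd p) : BSDp W p := by
  refine bsdp_of_pPartOver_of_bsdp_twist_quadratic_of_addv_unramified_oddPrime_bothLeOne W p K Wd W'
    hGZK hmod h2 hdodd hdsq hWd hW' hr hrd hp2 (fun v => ?_) hK hd
  rcases hS v with h | h | h | ⟨hadd, hnd⟩
  · exact Or.inl h
  · exact Or.inr (Or.inl h)
  · exact Or.inr (Or.inr (Or.inl h))
  · refine Or.inr (Or.inr (Or.inr ⟨hadd, hnd, fun hp3 hv3 => hnd ?_⟩))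
    rw [hv3, ← hp3]
    exact hpd

/-- **FILE F-2's UNIFORM END (merged S₁/S₂ hypothesis) for `r_an(W) ≤ 1` and `r_an(Wd) ≤ 1`
separately**: at every place `W` is good ∨ multiplicative ∨ (`ℓ ∣ d_K` ∧ `Wd` multiplicative) ∨
(additive with `ℓ ∤ d_K`, `ℓ ≥ 5` and `p ≥ 5`) — this population lies inside the previous theorem's
(`5 ≤ ℓ` gives `ℓ ≠ 3`). F-2's `bsdp_of_pPartOver_of_bsdp_twist_quadratic` with `hr` split.
[cite: Milne1972ArithmeticAV, §1 Thm. 1 and §2 (through DokchitserDokchitserAnnals2010, §2.1, proof of Thm. 8)]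
[cite: Miller2011LMS, Def. 1.1 (arXiv:1010.2431 p. 3)] -/
theorem bsdp_of_pPartOver_of_bsdp_twist_quadratic_bothLeOne
    (hGZK : rank_eq_analyticRank_of_analyticRank_le_one) (hmod : hasEntireLFunction_rat)
    (h2 : Module.finrank ℚ K = 2)
    (hdodd : Odd (NumberField.discr K)) (hdsq : Squarefree (NumberField.discr K))
    {Cd : VariableChange ℚ} (hWd : Cd • W.quadraticTwist (NumberField.discr K : ℚ) = Wd)
    {C' : VariableChange K} (hW' : C' • W.baseChange K = W')
    (hr : W.analyticRank ≤ 1) (hrd : Wd.analyticRank ≤ 1)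
    (hS : ∀ v : HeightOneSpectrum (𝓞 ℚ), W.HasGoodReductionAt v ∨ W.HasMultiplicativeReductionAt v ∨
      (((primesEquiv v : ℕ) : ℤ) ∣ NumberField.discr K ∧ Wd.HasMultiplicativeReductionAt v) ∨
      (W.HasAdditiveReductionAt v ∧ ¬ ((primesEquiv v : ℕ) : ℤ) ∣ NumberField.discr K ∧
        5 ≤ (primesEquiv v : ℕ) ∧ 5 ≤ p))
    (hp2 : p ≠ 2) (hK : MissingPPartOverAt W' p) (hd : BSDp Wd p) : BSDp W p := by
  refine bsdp_of_pPartOver_of_bsdp_twist_quadratic_of_addv_unramified_oddPrime_bothLeOne W p K Wd W'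
    hGZK hmod h2 hdodd hdsq hWd hW' hr hrd hp2 (fun v => ?_) hK hd
  rcases hS v with h | h | h | ⟨hadd, hnd, h5, -⟩
  · exact Or.inl h
  · exact Or.inr (Or.inl h)
  · exact Or.inr (Or.inr (Or.inl h))
  · exact Or.inr (Or.inr (Or.inr ⟨hadd, hnd, fun _ hv3 => by omega⟩))

/-- **THE END FOR THE CANONICAL FIELD `|d_K| = p`, NO LOCAL HYPOTHESIS, for `r_an(W) ≤ 1` and
`r_an(Wd) ≤ 1` separately**: `[K:ℚ] = 2` with `|d_K| = p` odd, `Wd = C_d • W^{(d_K)}` MULTIPLICATIVE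
at `p`, `W' = C' • W_K`, all globally minimal: **`BSDp W p ⟸ MissingPPartOverAt W' p ∧ BSDp Wd p`**
(`hGZK`, `hmod`). H-4b's `…_of_natAbs_discr` with `hr` split (`hS`, `hdodd`, `hdsq` by H-5c's
`localHyp_of_natAbs_discr`). [cite: Milne1972ArithmeticAV, §1 Thm. 1 and §2 (through DokchitserDokchitserAnnals2010, §2.1, proof of Thm. 8)]
[cite: SilvermanAEC2009, Prop. VII.5.4 (a)] [cite: Miller2011LMS, Def. 1.1 (arXiv:1010.2431 p. 3)] -/
theorem bsdp_of_pPartOver_of_bsdp_twist_quadratic_of_addv_unramified_of_natAbs_discr_bothLeOne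
    (hGZK : rank_eq_analyticRank_of_analyticRank_le_one) (hmod : hasEntireLFunction_rat)
    (h2 : Module.finrank ℚ K = 2) (hdK : (NumberField.discr K).natAbs = p)
    {Cd : VariableChange ℚ} (hWd : Cd • W.quadraticTwist (NumberField.discr K : ℚ) = Wd)
    {C' : VariableChange K} (hW' : C' • W.baseChange K = W')
    (hr : W.analyticRank ≤ 1) (hrd : Wd.analyticRank ≤ 1) (hp2 : p ≠ 2) (hmult : Mult Wd p)
    (hK : MissingPPartOverAt W' p) (hd : BSDp Wd p) : BSDp W p := by
  obtain ⟨hdodd, hdsq, hS⟩ := localHyp_of_natAbs_discr W p K Wd hdK hp2 hmult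
  exact bsdp_of_pPartOver_of_bsdp_twist_quadratic_of_addv_unramified_oddPrime_bothLeOne W p K Wd W'
    hGZK hmod h2 hdodd hdsq hWd hW' hr hrd hp2 hS hK hd

/-- **THE END FOR THE CANONICAL FIELD with `Mult Wd p` DISCHARGED from `PotMult W p`, for
`r_an(W) ≤ 1` and `r_an(Wd) ≤ 1` separately**: `W/ℚ` globally minimal, additive potentially
multiplicative at the odd prime `p`, `|d_K| = p`, `Wd = C_d • W^{(d_K)}`, `W' = C' • W_K` globally
minimal: `BSDp W p ⟸ MissingPPartOverAt W' p ∧ BSDp Wd p` (`hGZK`, `hmod`). H-5d's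
`…_of_natAbs_discr_of_potMult` without `hA` and with `hr` split
(`mult_twist_of_potMult_of_natAbs_discr`). [cite: SilvermanATAEC1994, V.5.3]
[cite: Milne1972ArithmeticAV, §1 Thm. 1 and §2 (through DokchitserDokchitserAnnals2010, §2.1, proof of Thm. 8)] -/
theorem bsdp_of_pPartOver_of_bsdp_twist_quadratic_of_addv_unramified_of_natAbs_discr_of_potMult_bothLeOne
    (hGZK : rank_eq_analyticRank_of_analyticRank_le_one) (hmod : hasEntireLFunction_rat)
    (h2 : Module.finrank ℚ K = 2) (hdK : (NumberField.discr K).natAbs = p)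
    {Cd : VariableChange ℚ} (hWd : Cd • W.quadraticTwist (NumberField.discr K : ℚ) = Wd)
    {C' : VariableChange K} (hW' : C' • W.baseChange K = W')
    (hr : W.analyticRank ≤ 1) (hrd : Wd.analyticRank ≤ 1) (hp2 : p ≠ 2) (hpm : PotMult W p)
    (hK : MissingPPartOverAt W' p) (hd : BSDp Wd p) : BSDp W p :=
  bsdp_of_pPartOver_of_bsdp_twist_quadratic_of_addv_unramified_of_natAbs_discr_bothLeOne W p K Wd W'
    hGZK hmod h2 hdK hWd hW' hr hrd hp2 (mult_twist_of_potMult_of_natAbs_discr W p K Wd hpm hp2 h2 hdK hWd)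
    hK hd

/-- **X4(M) WITH THE CANONICAL FIELD AND A TWIST OF ANALYTIC RANK `≤ 1`:
`BSD(E, p) ⇐ MissingPPartOverAt(E_K, p) ∧ BSD(E^{(p*)}, p)`.** For `(E,p) ∈ X4(M)` (odd additive `p`,
`E[p]` irreducible, `ord_p j < 0`) of analytic rank `≤ 1`, the quadratic field `K` with `|d_K| = p`
(so `d_K = p*`), `Wd = C_d • W^{(d_K)}` globally minimal of analytic rank `≤ 1`, `W' = C' • W_K`
globally minimal: inputs `hGZK`, `hmod` and NOTHING ELSE besides the two displayed hypotheses — the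
typed over-`K` input `hK : MissingPPartOverAt W' p` and `hd : BSDp Wd p`. When `r_an(Wd) = 0`, H-4b's
`bsdp_of_classX4M_of_rankZero_twist_noMilne_of_addv_unramified_canonical` discharges `hd` by Skinner
2016 Thm. C with (ram); when `r_an(Wd) = 1` the twist is a multiplicative `r = 1` pair (X11-type),
`hd` stays displayed, AND `hK` then concerns `W'/K` of analytic rank `2` (a harder typed residue than
in the rank-zero-twist case). [cite: SilvermanATAEC1994, V.5.3]
[cite: Milne1972ArithmeticAV, §1 Thm. 1 and §2 (through DokchitserDokchitserAnnals2010, §2.1, proof of Thm. 8)] -/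
theorem bsdp_of_classX4M_of_bsdp_twist_noMilne_of_addv_unramified_canonical
    (hGZK : rank_eq_analyticRank_of_analyticRank_le_one) (hmod : hasEntireLFunction_rat)
    (hX : ClassX4M W p) (hr : W.analyticRank ≤ 1) (h2 : Module.finrank ℚ K = 2)
    (hdK : (NumberField.discr K).natAbs = p)
    {Cd : VariableChange ℚ} (hWd : Cd • W.quadraticTwist (NumberField.discr K : ℚ) = Wd)
    (hrd : Wd.analyticRank ≤ 1)
    {C' : VariableChange K} (hW' : C' • W.baseChange K = W')
    (hK : MissingPPartOverAt W' p) (hd : BSDp Wd p) : BSDp W p :=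
  bsdp_of_pPartOver_of_bsdp_twist_quadratic_of_addv_unramified_of_natAbs_discr_of_potMult_bothLeOne W p K
    Wd W' hGZK hmod h2 hdK hWd hW' hr hrd hX.p_ne_two (ClassX4M.potMult W p hX) hK hd

/-- **X3♯(M) WITH THE CANONICAL FIELD AND A TWIST OF ANALYTIC RANK `≤ 1`:
`BSD(E, p) ⇐ MissingPPartOverAt(E_K, p) ∧ BSD(E^{(p*)}, p)`** — as the X4(M) twin, for
`(E,p) ∈ X3♯(M)` (`E[p]` reducible); the FULL `hd : BSDp Wd p` is displayed (no lower-half reduction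
here). When `r_an(Wd) = 0`, H-4b's `bsdp_of_classX3M_of_rankZero_twist_noMilne_of_addv_unramified_canonical`
reduces `hd` to the typed `MissingLowerBoundAt Wd p` (Wuthrich 2014 Prop. 21 upper half); when
`r_an(Wd) = 1`, `hK` concerns `W'/K` of analytic rank `2`. [cite: SilvermanATAEC1994, V.5.3]
[cite: Milne1972ArithmeticAV, §1 Thm. 1 and §2 (through DokchitserDokchitserAnnals2010, §2.1, proof of Thm. 8)] -/
theorem bsdp_of_classX3M_of_bsdp_twist_noMilne_of_addv_unramified_canonical
    (hGZK : rank_eq_analyticRank_of_analyticRank_le_one) (hmod : hasEntireLFunction_rat)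
    (hX : ClassX3M W p) (hr : W.analyticRank ≤ 1) (h2 : Module.finrank ℚ K = 2)
    (hdK : (NumberField.discr K).natAbs = p)
    {Cd : VariableChange ℚ} (hWd : Cd • W.quadraticTwist (NumberField.discr K : ℚ) = Wd)
    (hrd : Wd.analyticRank ≤ 1)
    {C' : VariableChange K} (hW' : C' • W.baseChange K = W')
    (hK : MissingPPartOverAt W' p) (hd : BSDp Wd p) : BSDp W p :=
  bsdp_of_pPartOver_of_bsdp_twist_quadratic_of_addv_unramified_of_natAbs_discr_of_potMult_bothLeOne W p K
    Wd W' hGZK hmod h2 hdK hWd hW' hr hrd (ClassX3M.p_ne_two W p hX) (ClassX3M.potMult W p hX) hK hd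

end BothLeOne

end Summit.BirchSwinnertonDyer.Rank1Residual.AdditivePotMult

end
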